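import Mathlib
import Literature.Computability.Complexity.CliqueTestGraphs
import Summits.PneNP.PneNP.Theorems.ConvexRankGatesConvexGateBlindColorings
import Summits.PneNP.PneNP.Theorems.ConvexRankGatesConvexGateBlindVertices

/-!
# PneNP / ConvexRankGates — `ConvexGateBlind`: one LP gate is an AND of few vertex thresholds

Helpers (`--supports stmt-PneNP-10680`) for the LP (diagonal) slice of the crux. A monotone
LP-feasibility gate `x ↦ [∃ z ≥ 0 (q variables), A z ≤ b + B x]` (`B ≥ 0`, `p` rows) is an AND of the
threshold rows `y · (b + B x) ≥ 0` over the at most `(p+1)^{q+1} 2^q` VERTICES `y` of its certificate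
polytope (`ConvexRankGatesConvexGateBlindVertices.lean`: Farkas, Krein–Milman, support count), each valid
on the accepted inputs (weak duality). Hence, ABSTRACTLY in a bound `N` on the number of
`(k-1)`-colourings of `K_m` that one valid non-negative threshold certificate can reject:
* `pow_le_mul_of_thresholdRows_separates` — `p` threshold rows separating `k`-cliques from colourings
  force `(k-1)^m ≤ p · N` (union bound; abstract form of `pow_le_mul_of_thresholdAnd_separates`);
* `pow_le_mul_of_lpGate_separates` — one LP gate doing so forces `(k-1)^m ≤ (p+1)^{q+1} 2^q · N`;
* `and_two_mem_lpFew`, `or_two_mem_lpFew`, `lpFew_subset_conv` — the gate class `LP_{s,t}` (`p + q ≤ s`,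
  `q ≤ t`) contains `∧₂`, `∨₂` and sits inside the route's `CONV_s` (diagonal `Aᵢ`);
* `not_computes_cliqueFn_of_lpFew` — if `(s+1)^{t+1} 2^t · N < (k-1)^m`, no one-gate circuit over
  `{∧₂, ∨₂} ∪ LP_{s,t}` computes `CLIQUE(m, k)`.
The concrete corner (with the matching count `N = k² m^{k²} (k-1)^{(m+k)/2+k²}` of
`ConvexRankGatesConvexGateBlindMatchingCount.lean`) is `ConvexRankGatesConvexGateBlindLinearVariables.lean`.
[folklore: LP duality / basic solutions]
-/

namespace Summit.PneNP.PneNP.Theorems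

open Matrix Finset Filter Topology

/-! ### An LP gate is an AND of vertex thresholds -/

section fewVariables

open Literature.Computability.Complexity

/-- **Union bound over rejecting rows, abstract count.** If every non-negative threshold certificate
valid on all `k`-clique vectors rejects at most `N` of the `(k-1)`-colouring vectors, and `p` non-negative
threshold rows accept every `k`-clique vector while every colouring vector violates some row, then
`(k-1)^m ≤ p · N` (a violated row has `bᵢ < 0`, so `(Bᵢ, -bᵢ)` is such a certificate). The instance
`N = k² (m/k+1)^{k²} (k-1)^{m-m/k+k²}` is `pow_le_mul_of_thresholdAnd_separates`. [folklore] -/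
theorem pow_le_mul_of_thresholdRows_separates {m k p N : ℕ}
    (hN : ∀ w : (⊤ : SimpleGraph (Fin m)).edgeSet → ℝ, (∀ e, 0 ≤ w e) → ∀ θ : ℝ, 0 < θ →
      (∀ Q : Finset (Fin m), Q.card = k → θ ≤ ∑ e, if cliqueVec Q e = true then w e else 0) →
      (univ.filter fun h : Fin m → Fin (k - 1) =>
        (∑ e, if colorVec h e = true then w e else 0) < θ).card ≤ N)
    (b : Fin p → ℝ) (B : Fin p → (⊤ : SimpleGraph (Fin m)).edgeSet → ℝ) (hB : ∀ i e, 0 ≤ B i e)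
    (hpos : ∀ Q : Finset (Fin m), Q.card = k →
      ∀ i, 0 ≤ b i + ∑ e, B i e * (if cliqueVec Q e then (1 : ℝ) else 0))
    (hneg : ∀ h : Fin m → Fin (k - 1),
      ∃ i, b i + ∑ e, B i e * (if colorVec h e then (1 : ℝ) else 0) < 0) :
    (k - 1) ^ m ≤ p * N := by
  classical
  have hsum_eq : ∀ (i : Fin p) (x : (⊤ : SimpleGraph (Fin m)).edgeSet → Bool),
      (∑ e, B i e * (if x e then (1 : ℝ) else 0)) = ∑ e, if x e = true then B i e else 0 := by
    intro i x
    refine Finset.sum_congr rfl fun e _ => ?_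
    split_ifs <;> simp
  have hbad : ∀ i : Fin p, (univ.filter fun h : Fin m → Fin (k - 1) =>
      (∑ e, if colorVec h e = true then B i e else 0) < -b i).card ≤ N := by
    intro i
    by_cases hb : 0 ≤ b i
    · have hempty : (univ.filter fun h : Fin m → Fin (k - 1) =>
          (∑ e, if colorVec h e = true then B i e else 0) < -b i) = ∅ := by
        refine Finset.filter_eq_empty_iff.2 fun h _ => not_lt.2 ?_
        have h0 : 0 ≤ ∑ e, if colorVec h e = true then B i e else 0 :=
          Finset.sum_nonneg fun e _ => by
            split_ifs
            · exact hB i e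
            · exact le_rfl
        linarith
      rw [hempty, Finset.card_empty]
      exact Nat.zero_le _
    · push Not at hb
      refine hN (B i) (hB i) (-b i) (by linarith) fun Q hQ => ?_
      have h1 := hpos Q hQ i
      rw [hsum_eq] at h1
      linarith
  have cover : (univ : Finset (Fin m → Fin (k - 1))) ⊆ (univ : Finset (Fin p)).biUnion fun i =>
      univ.filter fun h : Fin m → Fin (k - 1) =>
        (∑ e, if colorVec h e = true then B i e else 0) < -b i := by
    intro h _
    obtain ⟨i, hi⟩ := hneg h
    rw [hsum_eq] at hi
    exact Finset.mem_biUnion.2 ⟨i, Finset.mem_univ _,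
      Finset.mem_filter.2 ⟨Finset.mem_univ _, by linarith⟩⟩
  calc (k - 1) ^ m = (univ : Finset (Fin m → Fin (k - 1))).card := by
        rw [Finset.card_univ, Fintype.card_fun, Fintype.card_fin, Fintype.card_fin]
    _ ≤ ((univ : Finset (Fin p)).biUnion fun i => univ.filter fun h : Fin m → Fin (k - 1) =>
          (∑ e, if colorVec h e = true then B i e else 0) < -b i).card := Finset.card_le_card cover
    _ ≤ ∑ i, (univ.filter fun h : Fin m → Fin (k - 1) =>
          (∑ e, if colorVec h e = true then B i e else 0) < -b i).card := Finset.card_biUnion_le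
    _ ≤ ∑ _i : Fin p, N := Finset.sum_le_sum fun i _ => hbad i
    _ = p * N := by rw [Finset.sum_const, Finset.card_univ, Fintype.card_fin, smul_eq_mul]

/-- A combination of the rows `bᵢ + ∑ₑ Bᵢₑ [xₑ]` is the row `(∑ᵢ yᵢ bᵢ) + ∑ₑ (∑ᵢ yᵢ Bᵢₑ) [xₑ]`. [folklore] -/
theorem sum_mul_rows_eq {ι : Type*} [Fintype ι] {p : ℕ} (y : Fin p → ℝ) (b : Fin p → ℝ)
    (B : Fin p → ι → ℝ) (v : ι → ℝ) :
    ∑ i, y i * (b i + ∑ e, B i e * v e) = ∑ i, y i * b i + ∑ e, (∑ i, y i * B i e) * v e := by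
  simp only [mul_add, Finset.sum_add_distrib, Finset.mul_sum, Finset.sum_mul]
  congr 1
  rw [Finset.sum_comm]
  exact Finset.sum_congr rfl fun i _ => Finset.sum_congr rfl fun e _ => by ring

/-- **LP gates with few variables cannot separate cliques from colourings cheaply.** If a monotone
LP-feasibility gate with `p` rows and `q` variables, `x ↦ [∃ z ≥ 0, A z ≤ b + B x]` (`B ≥ 0`), accepts
every `k`-clique vector (`k ≥ 2`) and rejects every `(k-1)`-colouring vector of `K_m`, then
`(k-1)^m ≤ (p+1)^{q+1} 2^q · N`, where `N` bounds the colourings rejected by one valid non-negative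
threshold certificate: by Farkas and Krein–Milman every rejected input is rejected by the threshold row
of a VERTEX of the certificate polytope `Π(A)`, these rows accept every accepted input (weak duality),
there are at most `(p+1)^{q+1} 2^q` vertices (`ncard_extremePoints_certPolytope_le`), and
`pow_le_mul_of_thresholdRows_separates` is the union bound. [folklore] -/
theorem pow_le_mul_of_lpGate_separates {m k p q N : ℕ}
    (hN : ∀ w : (⊤ : SimpleGraph (Fin m)).edgeSet → ℝ, (∀ e, 0 ≤ w e) → ∀ θ : ℝ, 0 < θ →
      (∀ Q : Finset (Fin m), Q.card = k → θ ≤ ∑ e, if cliqueVec Q e = true then w e else 0) →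
      (univ.filter fun h : Fin m → Fin (k - 1) =>
        (∑ e, if colorVec h e = true then w e else 0) < θ).card ≤ N)
    (A : Fin p → Fin q → ℝ)
    (b : Fin p → ℝ) (B : Fin p → (⊤ : SimpleGraph (Fin m)).edgeSet → ℝ) (hB : ∀ i e, 0 ≤ B i e)
    (hpos : ∀ Q : Finset (Fin m), Q.card = k → ∃ z : Fin q → ℝ, (∀ j, 0 ≤ z j) ∧
      ∀ i, ∑ j, A i j * z j ≤ b i + ∑ e, B i e * (if cliqueVec Q e then (1 : ℝ) else 0))
    (hneg : ∀ h : Fin m → Fin (k - 1), ¬ ∃ z : Fin q → ℝ, (∀ j, 0 ≤ z j) ∧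
      ∀ i, ∑ j, A i j * z j ≤ b i + ∑ e, B i e * (if colorVec h e then (1 : ℝ) else 0)) :
    (k - 1) ^ m ≤ (p + 1) ^ (q + 1) * 2 ^ q * N := by
  classical
  set P : Set (Fin p → ℝ) := {y : Fin p → ℝ | (∀ i, 0 ≤ y i) ∧ (∀ j, 0 ≤ ∑ i, y i * A i j) ∧
    ∑ i, y i = 1} with hP
  obtain ⟨hfin, hcard⟩ := ncard_extremePoints_certPolytope_le A
  set EF : Finset (Fin p → ℝ) := hfin.toFinset with hEF
  set T : ℕ := EF.card with hT
  have hTle : T ≤ (p + 1) ^ (q + 1) * 2 ^ q := by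
    rw [hT, hEF, ← Set.ncard_eq_toFinset_card _ hfin]
    exact hcard
  -- the vertex rows
  let vert : Fin T → Fin p → ℝ := fun t => (EF.equivFin.symm t : Fin p → ℝ)
  have hvertE : ∀ t, vert t ∈ P.extremePoints ℝ := fun t =>
    hfin.mem_toFinset.1 (EF.equivFin.symm t).2
  have hvertP : ∀ t, vert t ∈ P := fun t => (hvertE t).1
  let b' : Fin T → ℝ := fun t => ∑ i, vert t i * b i
  let B' : Fin T → (⊤ : SimpleGraph (Fin m)).edgeSet → ℝ := fun t e => ∑ i, vert t i * B i e
  have hB' : ∀ t e, 0 ≤ B' t e :=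
    fun t e => Finset.sum_nonneg fun i _ => mul_nonneg ((hvertP t).1 i) (hB i e)
  have hrow : ∀ (t : Fin T) (x : (⊤ : SimpleGraph (Fin m)).edgeSet → Bool),
      b' t + ∑ e, B' t e * (if x e then (1 : ℝ) else 0) =
        ∑ i, vert t i * (b i + ∑ e, B i e * (if x e then (1 : ℝ) else 0)) := by
    intro t x
    rw [sum_mul_rows_eq]
  have hpos' : ∀ Q : Finset (Fin m), Q.card = k →
      ∀ t, 0 ≤ b' t + ∑ e, B' t e * (if cliqueVec Q e then (1 : ℝ) else 0) := by
    intro Q hQ t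
    rw [hrow]
    exact sum_mul_nonneg_of_feasible A (hvertP t).1 (hvertP t).2.1 (hpos Q hQ)
  have hneg' : ∀ h : Fin m → Fin (k - 1),
      ∃ t, b' t + ∑ e, B' t e * (if colorVec h e then (1 : ℝ) else 0) < 0 := by
    intro h
    set r : Fin p → ℝ := fun i => b i + ∑ e, B i e * (if colorVec h e then (1 : ℝ) else 0) with hr
    obtain ⟨y, hyP, hyneg⟩ := exists_mem_certPolytope_of_infeasible A r (hneg h)
    obtain ⟨v, hvE, hvneg⟩ := exists_extremePoint_sum_mul_neg (isCompact_certPolytope A)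
      (convex_certPolytope A) r hyP hyneg
    have hvEF : v ∈ EF := by rw [hEF, Set.Finite.mem_toFinset]; exact hvE
    refine ⟨EF.equivFin ⟨v, hvEF⟩, ?_⟩
    rw [hrow]
    have hvt : vert (EF.equivFin ⟨v, hvEF⟩) = v := by
      simp [vert]
    rw [hvt]
    exact hvneg
  have hle := pow_le_mul_of_thresholdRows_separates hN b' B' hB' hpos' hneg'
  exact hle.trans (Nat.mul_le_mul_right _ hTle)

/-! ### The LP gate class with few variables -/

/-- `∧₂` is an LP gate with one row and no variables: `v₀ ∧ v₁ ↔ 0 ≤ -2 + [v₀] + [v₁]`. [folklore] -/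
theorem and_two_mem_lpFew {s t : ℕ} (hs : 1 ≤ s) :
    GateFn.and 2 ∈ {g : GateFn | ∃ p q : ℕ, p + q ≤ s ∧ q ≤ t ∧
      ∃ (A : Fin p → Fin q → ℝ) (b : Fin p → ℝ) (B : Fin p → Fin g.1 → ℝ), (∀ i j, 0 ≤ B i j) ∧
        ∀ v : Fin g.1 → Bool, g.2 v = true ↔ ∃ z : Fin q → ℝ, (∀ j, 0 ≤ z j) ∧
          ∀ i, ∑ j, A i j * z j ≤ b i + ∑ j, B i j * (if v j then (1 : ℝ) else 0)} := by
  refine ⟨1, 0, by simpa using hs, Nat.zero_le _, fun _ _ => 0, fun _ => -2, fun _ _ => 1,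
    fun _ _ => zero_le_one, ?_⟩
  show ∀ v : Fin 2 → Bool, decide (∀ i, v i = true) = true ↔ ∃ z : Fin 0 → ℝ, (∀ j, 0 ≤ z j) ∧
    ∀ i : Fin 1, ∑ j : Fin 0, (0 : ℝ) * z j ≤ -2 + ∑ j, 1 * (if v j then (1 : ℝ) else 0)
  intro v
  simp only [decide_eq_true_eq, Fin.forall_fin_one, Fin.forall_fin_two, Fin.sum_univ_two, one_mul,
    Finset.univ_eq_empty, Finset.sum_empty, IsEmpty.forall_iff, true_and, exists_const]
  cases v 0 <;> cases v 1 <;> norm_num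

/-- `∨₂` is an LP gate with one row and no variables: `v₀ ∨ v₁ ↔ 0 ≤ -1 + [v₀] + [v₁]`. [folklore] -/
theorem or_two_mem_lpFew {s t : ℕ} (hs : 1 ≤ s) :
    GateFn.or 2 ∈ {g : GateFn | ∃ p q : ℕ, p + q ≤ s ∧ q ≤ t ∧
      ∃ (A : Fin p → Fin q → ℝ) (b : Fin p → ℝ) (B : Fin p → Fin g.1 → ℝ), (∀ i j, 0 ≤ B i j) ∧
        ∀ v : Fin g.1 → Bool, g.2 v = true ↔ ∃ z : Fin q → ℝ, (∀ j, 0 ≤ z j) ∧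
          ∀ i, ∑ j, A i j * z j ≤ b i + ∑ j, B i j * (if v j then (1 : ℝ) else 0)} := by
  refine ⟨1, 0, by simpa using hs, Nat.zero_le _, fun _ _ => 0, fun _ => -1, fun _ _ => 1,
    fun _ _ => zero_le_one, ?_⟩
  show ∀ v : Fin 2 → Bool, decide (∃ i, v i = true) = true ↔ ∃ z : Fin 0 → ℝ, (∀ j, 0 ≤ z j) ∧
    ∀ i : Fin 1, ∑ j : Fin 0, (0 : ℝ) * z j ≤ -1 + ∑ j, 1 * (if v j then (1 : ℝ) else 0)
  intro v
  simp only [decide_eq_true_eq, Fin.forall_fin_one, Fin.exists_fin_two, Fin.sum_univ_two, one_mul,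
    Finset.univ_eq_empty, Finset.sum_empty, IsEmpty.forall_iff, true_and, exists_const]
  cases v 0 <;> cases v 1 <;> norm_num

/-- Every LP gate (`p` rows, `q` variables, `p + q ≤ s`) is a CONV gate of the route of size `s`: take
`Aᵢ = diagonal (row i)`; a feasible `z ≥ 0` gives the PSD witness `diagonal z`, and a PSD witness `Y`
gives the feasible `z = diag Y ≥ 0`. So the class below is the "diagonal, few variables" slice of the
`Conv s` inlined in the route's items. [folklore] -/
theorem lpFew_subset_conv (s t : ℕ) :
    {g : GateFn | ∃ p q : ℕ, p + q ≤ s ∧ q ≤ t ∧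
      ∃ (A : Fin p → Fin q → ℝ) (b : Fin p → ℝ) (B : Fin p → Fin g.1 → ℝ), (∀ i j, 0 ≤ B i j) ∧
        ∀ v : Fin g.1 → Bool, g.2 v = true ↔ ∃ z : Fin q → ℝ, (∀ j, 0 ≤ z j) ∧
          ∀ i, ∑ j, A i j * z j ≤ b i + ∑ j, B i j * (if v j then (1 : ℝ) else 0)}
    ⊆ {g : GateFn | ∃ (p q : ℕ), p + q ≤ s ∧ ∃ (A : Fin p → Matrix (Fin q) (Fin q) ℝ) (b : Fin p → ℝ)
      (B : Fin p → Fin g.1 → ℝ), (∀ i j, 0 ≤ B i j) ∧ ∀ v : Fin g.1 → Bool, g.2 v = true ↔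
        ∃ Y : Matrix (Fin q) (Fin q) ℝ, Y.PosSemidef ∧
          ∀ i, (A i * Y).trace ≤ b i + ∑ j, B i j * (if v j then (1 : ℝ) else 0)} := by
  rintro g ⟨p, q, hpq, -, A, b, B, hB, hiff⟩
  refine ⟨p, q, hpq, fun i => Matrix.diagonal (A i), b, B, hB, fun v => ?_⟩
  rw [hiff]
  have htr : ∀ (i : Fin p) (Y : Matrix (Fin q) (Fin q) ℝ),
      (Matrix.diagonal (A i) * Y).trace = ∑ j, A i j * Y j j := by
    intro i Y
    simp only [Matrix.trace, Matrix.diag_apply, Matrix.diagonal_mul]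
  constructor
  · rintro ⟨z, hz, hrows⟩
    refine ⟨Matrix.diagonal z, Matrix.PosSemidef.diagonal fun j => hz j, fun i => ?_⟩
    rw [htr]
    simpa [Matrix.diagonal_apply_eq] using hrows i
  · rintro ⟨Y, hY, hrows⟩
    refine ⟨fun j => Y j j, fun j => hY.diag_nonneg, fun i => ?_⟩
    have h := hrows i
    rwa [htr] at h

/-- **One LP gate with few variables does not compute CLIQUE, finite form.** If `k ≥ 3` and
`(s+1)^{t+1} 2^t · N < (k-1)^m` (`N` as in `pow_le_mul_of_lpGate_separates`), no circuit with at most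
one gate over `{∧₂, ∨₂} ∪ LP_{s,t}` (LP gates with `p + q ≤ s` and `q ≤ t` variables) computes `CLIQUE(m, k)`:
a gate-free circuit outputs an input edge (refuted by a colouring separating its ends); a one-gate
circuit reads input wires only, so it is one LP gate in the edge variables and
`pow_le_mul_of_lpGate_separates` applies. [folklore] -/
theorem not_computes_cliqueFn_of_lpFew {m k s t N : ℕ} (hk : 3 ≤ k) (hs : 1 ≤ s)
    (hN : ∀ w : (⊤ : SimpleGraph (Fin m)).edgeSet → ℝ, (∀ e, 0 ≤ w e) → ∀ θ : ℝ, 0 < θ →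
      (∀ Q : Finset (Fin m), Q.card = k → θ ≤ ∑ e, if cliqueVec Q e = true then w e else 0) →
      (univ.filter fun h : Fin m → Fin (k - 1) =>
        (∑ e, if colorVec h e = true then w e else 0) < θ).card ≤ N)
    (hnum : (s + 1) ^ (t + 1) * 2 ^ t * N < (k - 1) ^ m)
    (C : Circuit ((⊤ : SimpleGraph (Fin m)).edgeSet))
    (hC : C.IsOver ({GateFn.and 2, GateFn.or 2} ∪ {g : GateFn | ∃ p q : ℕ, p + q ≤ s ∧ q ≤ t ∧
      ∃ (A : Fin p → Fin q → ℝ) (b : Fin p → ℝ) (B : Fin p → Fin g.1 → ℝ), (∀ i j, 0 ≤ B i j) ∧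
        ∀ v : Fin g.1 → Bool, g.2 v = true ↔ ∃ z : Fin q → ℝ, (∀ j, 0 ≤ z j) ∧
          ∀ i, ∑ j, A i j * z j ≤ b i + ∑ j, B i j * (if v j then (1 : ℝ) else 0)}))
    (hsize : C.size ≤ 1) : ¬ C.Computes (cliqueFn m k) := by
  classical
  intro hcomp
  have hk1 : k - 1 < k := by omega
  have hproj : ∀ e : (⊤ : SimpleGraph (Fin m)).edgeSet, (∀ x, C.eval x = x e) → False := by
    intro e he
    obtain ⟨a, a', hab⟩ := sym2_exists_eq_mk (e : Sym2 (Fin m))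
    have hne : a ≠ a' := by
      have hmem := e.2
      rw [hab, SimpleGraph.mem_edgeSet, SimpleGraph.top_adj] at hmem
      exact hmem
    let h : Fin m → Fin (k - 1) := fun v => if v = a then ⟨0, by omega⟩ else ⟨1, by omega⟩
    have h1 : colorVec h e = true := by
      simp only [colorVec, Bool.not_eq_true', decide_eq_false_iff_not]
      rw [hab, Sym2.map_mk, Sym2.mk_isDiag_iff]
      simp only [h, if_pos rfl, if_neg (Ne.symm hne)]
      exact fun heq => absurd (Fin.mk.inj_iff.1 heq) (by norm_num)
    have h2 := hcomp (colorVec h)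
    rw [he, h1, cliqueFn_colorVec h hk1] at h2
    exact Bool.noConfusion h2
  obtain ⟨gates, out, wf, wf_out⟩ := C
  rcases out with e | n
  · exact hproj e fun x => rfl
  · have hn : n < gates.length := wf_out n rfl
    have hlen : gates.length = 1 := by
      change gates.length ≤ 1 at hsize
      omega
    obtain ⟨g, rfl⟩ := List.length_eq_one_iff.1 hlen
    have hn0 : n = 0 := by simp at hn; omega
    subst hn0
    have hev : ∀ x : (⊤ : SimpleGraph (Fin m)).edgeSet → Bool,
        Circuit.eval ⟨[g], Sum.inr 0, wf, wf_out⟩ x =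
          g.op (fun a => Sum.elim x (fun _ => false) (g.args a)) := by
      intro x
      simp only [Circuit.eval, Circuit.wireVals, List.foldl_cons, List.foldl_nil, List.nil_append,
        List.getD_cons_zero]
      congr 1
      funext a
      cases g.args a <;> simp
    have hg : g.fn ∈ {g : GateFn | ∃ p q : ℕ, p + q ≤ s ∧ q ≤ t ∧
        ∃ (A : Fin p → Fin q → ℝ) (b : Fin p → ℝ) (B : Fin p → Fin g.1 → ℝ), (∀ i j, 0 ≤ B i j) ∧
          ∀ v : Fin g.1 → Bool, g.2 v = true ↔ ∃ z : Fin q → ℝ, (∀ j, 0 ≤ z j) ∧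
            ∀ i, ∑ j, A i j * z j ≤ b i + ∑ j, B i j * (if v j then (1 : ℝ) else 0)} := by
      have h1 := hC g (by simp)
      rcases h1 with h1 | h1
      · rcases h1 with h1 | h1
        · rw [h1]; exact and_two_mem_lpFew hs
        · rw [Set.mem_singleton_iff.1 h1]; exact or_two_mem_lpFew hs
      · exact h1
    obtain ⟨p, q, hpq, hqt, A, b, B, hB, hiff⟩ := hg
    let B' : Fin p → (⊤ : SimpleGraph (Fin m)).edgeSet → ℝ :=
      fun i e => ∑ j ∈ univ.filter (fun j : Fin g.arity => g.args j = Sum.inl e), B i j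
    have hB' : ∀ i e, 0 ≤ B' i e := fun i e => Finset.sum_nonneg fun j _ => hB i j
    have hind : ∀ (x : (⊤ : SimpleGraph (Fin m)).edgeSet → Bool) (j : Fin g.arity),
        (if Sum.elim x (fun _ => false) (g.args j) then (1 : ℝ) else 0)
          = ∑ e, if g.args j = Sum.inl e then (if x e then (1 : ℝ) else 0) else 0 := by
      intro x j
      rcases hja : g.args j with e₀ | n₀
      · simp only [Sum.elim_inl, Sum.inl.injEq]
        rw [Finset.sum_ite_eq]
        simp
      · simp
    have hkey : ∀ (x : (⊤ : SimpleGraph (Fin m)).edgeSet → Bool) (i : Fin p),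
        (∑ j, B i j * (if Sum.elim x (fun _ => false) (g.args j) then (1 : ℝ) else 0))
          = ∑ e, B' i e * (if x e then (1 : ℝ) else 0) := by
      intro x i
      simp_rw [hind, Finset.mul_sum, B', Finset.sum_mul]
      rw [Finset.sum_comm]
      refine Finset.sum_congr rfl fun e _ => ?_
      rw [Finset.sum_filter]
      refine Finset.sum_congr rfl fun j _ => ?_
      split_ifs <;> simp
    have hpos : ∀ Q : Finset (Fin m), Q.card = k → ∃ z : Fin q → ℝ, (∀ j, 0 ≤ z j) ∧
        ∀ i, ∑ j, A i j * z j ≤ b i + ∑ e, B' i e * (if cliqueVec Q e then (1 : ℝ) else 0) := by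
      intro Q hQ
      have h1 := hcomp (cliqueVec Q)
      rw [hev, cliqueFn_cliqueVec hQ.ge] at h1
      obtain ⟨z, hz, hrows⟩ := (hiff _).1 h1
      refine ⟨z, hz, fun i => ?_⟩
      have h2 := hrows i
      rwa [hkey] at h2
    have hneg : ∀ h : Fin m → Fin (k - 1), ¬ ∃ z : Fin q → ℝ, (∀ j, 0 ≤ z j) ∧
        ∀ i, ∑ j, A i j * z j ≤ b i + ∑ e, B' i e * (if colorVec h e then (1 : ℝ) else 0) := by
      intro h hz
      have h1 := hcomp (colorVec h)
      rw [hev, cliqueFn_colorVec h hk1] at h1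
      have h3 : g.op (fun a => Sum.elim (colorVec h) (fun _ => false) (g.args a)) = true := by
        refine (hiff _).2 ?_
        obtain ⟨z, hz0, hrows⟩ := hz
        refine ⟨z, hz0, fun i => ?_⟩
        rw [hkey]
        exact hrows i
      rw [h3] at h1
      exact Bool.noConfusion h1
    have hle := pow_le_mul_of_lpGate_separates hN A b B' hB' hpos hneg
    have hmono : (p + 1) ^ (q + 1) * 2 ^ q ≤ (s + 1) ^ (t + 1) * 2 ^ t := by
      have hp : p ≤ s := by omega
      calc (p + 1) ^ (q + 1) * 2 ^ q ≤ (s + 1) ^ (q + 1) * 2 ^ q :=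
            Nat.mul_le_mul_right _ (Nat.pow_le_pow_left (by omega) _)
        _ ≤ (s + 1) ^ (t + 1) * 2 ^ t :=
            Nat.mul_le_mul (Nat.pow_le_pow_right (by omega) (by omega))
              (Nat.pow_le_pow_right (by norm_num) hqt)
    have hle' := hle.trans (Nat.mul_le_mul_right _ hmono)
    omega

end fewVariables

end Summit.PneNP.PneNP.Theorems
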